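import Literature.MathematicalPhysics.QuantumFieldTheory.Balaban1983to89.B9Thm33G0DirXHolderFromDds

/-!
# `Balaban1983to89.B9Thm313WholeDvHolderFromDds` — [B9] Theorems 3.12–3.13 (pp. 420–426): THE HÖLDER-SOURCE MEMBERS OF THE D_U-ORBIT OF ROWS 20–21
# (D*G₀D_U, ∇_{U,ν}G₀D_U, ∇_UG₀D_U, Φ_β∘∇G₀D_U) ARE THE DIRECTIONAL (3.44)∕(3.45) MEMBERS OF THEOREM 3.3 FOR G₀ COMPOSED WITH THE KINEMATIC
# DECOMPOSITION D_U = Σ_μ ∇*_{U,μ}∘J_μ AND A HÖLDER LETTER FOR J_μ — four displayed letter fields become theorems of rows 19's derived material and ONE J-letter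

T. Bałaban, *Propagators for lattice gauge theories in a background field*, Commun. Math. Phys. **99** (1985) 389–434
[`Balaban1985BackgroundPropagators`, "B9"]; [4] = T. Bałaban, *Propagators and renormalization transformations for lattice gauge
theories. II*, Commun. Math. Phys. **96** (1984) 223–250 [`Balaban1984PropagatorsII`].

statement-level skeleton of published theorems with citation tags; proofs where landed; nothing here is a claim about the Yang–Mills
mass gap

THE PRINTED LOCUS (held text `paper:balaban1985-cmp99-background-propagators`).  (3.3) p. 390 (`D_U`), (3.8) p. 392 (`∇*_{U,μ}`); Theorem 3.3 p. 399 with (3.44)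
p. 398: *"|(∇_UG(U)∇\*_Uλ)(x)| ≦ B′₀(ε)e^{−δ₀d(y,y′)}(‖λ‖_ε + |λ|)"* and (3.45) p. 398: *"‖ζ∇_UG(U)∇\*_Uλ‖_α ≦ B′₀(ε,α)(Lʲη)^{−α}(‖ζ‖^ξ_α + |ζ|)e^{−δ₀d(y,y′)}(‖λ‖_{α+ε} +
|λ|)"*; p. 398: *"we may always replace ∇_U by ∇\*_U … in arbitrary place and combination"*, *"the choice of powers Lʲη is conventional"*; (3.152)–(3.153) p. 426
(the operators ∇_UG₀D_U, D\*G₀D_U of the expansion of 𝔊 and H₁); [4] (2.26) p. 228, (2.52)–(2.56) pp. 232–233, Lemma 2.1 (2.60)–(2.61) p. 234.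

THE POINT.  `B9Thm313WholeDvFromDds` (g17) left four Sect.-D letter fields of rows 20–21 with a HÖLDER source class untreated — `Thm33G0DivR.h44DsDv`
(D\*G₀D_U : `bHW ε` → 𝔠_W⁽⁰⁾), `Letters313DMZ.dgDHd ν` (∇_{U,ν}G₀D_U : `bH` → 𝔠⁽¹⁾), `Letters313DZ.dgDH` (∇_UG₀D_U : `bH` → 𝔠_Y⁽¹⁾), `Letters313HZ.pYDH β`
(Φ^Y_β∘∇_U∘G₀∘D_U : `bW` → 𝔠_{P_Y}^{(β−1)}) — because `J_μ` between Hölder classes is not a sup-class letter.  With the Hölder letter of `J_μ` now typed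
(`B9GradViaDivLettersAtPinsHolder.hasMaj_JcoKH_holder(_pins ∕ _len)`, under its explicit small-field-gauge binder), THIS FILE types the compositions ([4]
(2.52)–(2.56), the row sum of Lemma 2.1 spent on the J-letter, the scale re-weightings of p. 398 by (2.60)) in the conventions of n06-w6's
`B9Thm33G0DirXHolderFromDds` (whose §0 adapters `hasMaj_lenInv_of_len`, `hasMaj_cNormR_of_ofBlocks_rpow_lenInv` are re-used BY NAME):
* §0 plumbing: `comp_comp_dv_eq_fsum` (`E∘(A∘D_U) = Σ_μ (E∘(A∘∇\*_{U,μ}))∘J_μ`), ★ `hasMaj_cNorm_one_of_ofBlocks_lenInv` (a (3.44)-shape sharp-block majorant read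
  from the source rescaled by `(L^{j′}η)⁻¹` lands in 𝔠⁽¹⁾, cost `L`, rate `αδ` — the 𝔠⁽¹⁾ twin of n06-w6's rpow adapter);
* §1 ★★ `h44DsDv_of_h44Ds` — `Thm33G0DivR.h44DsDv ε` ⟸ its own directional field `h44Ds μ ε` + the NO-LENGTH J-letter `bHW ε → bHX ε` (both pinned input classes at
  one exponent; `B_dD ≥ |P|·κ_X·B_iD·C_J·c`);
* §2 ★★ `dgDHd_of_h44m` — `Letters313DMZ.dgDHd ν` (source `bH` FREE) ⟸ `Thm33G0Dir.h44m (ν,μ) ε` + the WITH-LENGTH J-letter `bH → bHX ε` (`C_J·(Lʲη)·e^{−δ_J d}`, the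
  shape `pXdDH_of_h45m` reads; `B₃ ≥ |P|·κ₀·B_i·L₀·C_J·c`, rate `δ₃ ≤ δ₀ − αδ`); ★ `dgDH_of_h44m` — `Letters313DZ.dgDH` with the slice-diagonal ∇_U written
  `Σ_ν Π_ν∘∇_{U,ν}` (`hD`, `hPr`, as in g17's `dGDv_l2_of_l4m`);
* §3 ★★ `pYDH_of_h45Y` — `Letters313HZ.pYDH β` (source `bW` FREE) from a DIRECTIONAL Φ^Y-(3.45) member `Φ^Y_β∘∇_U∘G₀∘∇\*_{U,μ} : bHX → Y-probe blocks,
  B_i·(Lʲη)^{−β}·e^{−δ₀d}` (a hypothesis: the Y-probe relabelling of `h45m` is not typed here) and the with-length J-letter — the bundled-∇_U, Y-probe twin of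
  `pXdDH_of_h45m`.
So at the knit, with `bH13 := weightNorm (bHS (sIK bI) 1) (Lʲη)⁻¹` (n06-w6's suggested pin) and `hJ := hasMaj_JcoKH_holder_len … (ε := 1)`: `dgDHd`, `dgDH`, `pYDH`
(and n06-w6's `pXdDH`) become theorems of `hG0C` + pins + ONE binder `hΘ` on `U`; `h44DsDv ε` of `hasMaj_JcoKH_holder_pins … ε` + `h44Ds`.

HONEST SCOPE.  Kernel bookkeeping over landed modules; the directional members and the J-letter are HYPOTHESES of these theorems (the J-letter is
supplied at def-Y's pins by `B9GradViaDivLettersAtPinsHolder` under the binder `hΘ` on `U` — a statement about `U` in small-gauge position, see that file's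
LOCATED note); nothing of print's estimates asserted; COUNT-NEUTRAL; N06 NOT discharged; one finite lattice at a time; nothing continuum, nothing about the
mass gap.  Cell `pub-ymgap` (HUMAN RULING D-0062), Track A node N06 [B9], rows 20–21 (bundle F7), seat `pub-ymgap-dag-n06-l` (g18), 2026-08-28.
-/

namespace Literature.MathematicalPhysics.QuantumFieldTheory.Balaban1983to89.B9Thm313WholeDvHolderFromDds

open Literature.MathematicalPhysics.QuantumFieldTheory.Balaban1983to89
open Finset B6RandomWalk B6RandomWalkHom B9Thm34Ext B11SectG B9SectDSup B9SectDL2Decay B9Thm37Glue B9Thm312Whole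
open B9Thm312WholeClasses B9RWSums343to347Whole B9RWSums346Schur B9PerturbationMajorantAlgebra

noncomputable section

variable {g : B9.Geometry} {X Y W P : Type} [Fintype X] [Fintype Y] [Fintype W] [Fintype P] [Fintype g.Site]
variable {R₀ : ℝ} {H₀ : Prop}

/-! ## §0 Plumbing: composition over finite sums; weights on the target; the scale re-weightings of p. 398 -/

/-- Post-composition distributes over finite sums of linear maps (private plumbing). [folklore] -/
private theorem comp_fsum {ι M N K : Type} [AddCommGroup M] [Module ℝ M] [AddCommGroup N] [Module ℝ N] [AddCommGroup K] [Module ℝ K]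
    (s : Finset ι) (A : N →ₗ[ℝ] K) (T : ι → M →ₗ[ℝ] N) : A ∘ₗ (∑ i ∈ s, T i) = ∑ i ∈ s, A ∘ₗ T i := by
  apply LinearMap.ext
  intro f
  simp only [LinearMap.comp_apply, LinearMap.sum_apply, map_sum]

/-- Pre-composition distributes over finite sums of linear maps (private plumbing). [folklore] -/
private theorem fsum_comp {ι M N K : Type} [AddCommGroup M] [Module ℝ M] [AddCommGroup N] [Module ℝ N] [AddCommGroup K] [Module ℝ K]
    (s : Finset ι) (A : M →ₗ[ℝ] N) (T : ι → N →ₗ[ℝ] K) : (∑ i ∈ s, T i) ∘ₗ A = ∑ i ∈ s, T i ∘ₗ A := by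
  apply LinearMap.ext
  intro f
  simp only [LinearMap.comp_apply, LinearMap.sum_apply]

omit [Fintype X] [Fintype Y] [Fintype W] in
/-- **THE KINEMATIC REWRITING WITH A LEFT FACTOR**: `D_U = Σ_μ ∇*_{U,μ}∘J_μ ⇒ A∘(G₀∘D_U) = Σ_μ (A∘(G₀∘∇*_{U,μ}))∘J_μ`.
[cite: Balaban1985BackgroundPropagators, (3.3) p.390 + (3.8) p.392 + p.398 (remark after (3.47))] -/
theorem comp_comp_dv_eq_fsum {V V' : Type} {Dds : P → Module.End ℝ (X → ℝ)} {J : P → (W → ℝ) →ₗ[ℝ] (X → ℝ)} {Dv : (W → ℝ) →ₗ[ℝ] (X → ℝ)}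
    (hDv : Dv = ∑ μ, Dds μ ∘ₗ J μ) (A : (X → ℝ) →ₗ[ℝ] (V → ℝ)) (E : (V → ℝ) →ₗ[ℝ] (V' → ℝ)) :
    E ∘ₗ (A ∘ₗ Dv) = ∑ μ, (E ∘ₗ (A ∘ₗ Dds μ)) ∘ₗ J μ := by
  rw [B9Thm313WholeDvFromDds.comp_dv_eq_fsum hDv A, comp_fsum]
  rfl

omit [Fintype Y] [Fintype W] [Fintype P] in
/-- ★ **A SHARP-BLOCK MAJORANT READ FROM THE SOURCE RESCALED BY (L^{j′}η)⁻¹ IS A MAJORANT INTO 𝔠⁽¹⁾, ONE TRANSFER**: if `T` has the majorant `C·e^{−rd}` from a block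
norm `b` into the sharp blocks of `X` (a (3.44) shape: no power at the output), then from `b` rescaled by `(L^{j′}η)⁻¹` into 𝔠⁽¹⁾ (weight `(Lʲη)⁻¹` at the output) it has
`C·L·e^{−(r−αδ)d}` — the ratio `L^{j′}η ∕ Lʲη` costs `L·e^{αδd}` ([4] (2.60), `B9RWSums346Schur.scaleTransfer_len_rpow` at γ = 1; the 𝔠⁽¹⁾ twin of n06-w6's
`hasMaj_cNormR_of_ofBlocks_rpow_lenInv`). [cite: Balaban1985BackgroundPropagators, (3.44) p.398 + p.398 (remark after (3.47)); Balaban1984PropagatorsII, (2.51) p.232 + Lemma 2.1 (2.60) p.234] -/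
theorem hasMaj_cNorm_one_of_ofBlocks_lenInv (hG : GeoOK g) {dF : ℕ} {δ α L₀ : ℝ} (hF : Facts347 g R₀ H₀ dF δ α L₀)
    {F₁ : Type} [AddCommGroup F₁] [Module ℝ F₁] {b : BlockNorm (toB6 g R₀ H₀) F₁} {blk : X → g.Site} {T : F₁ →ₗ[ℝ] (X → ℝ)} {C r : ℝ} (hC : 0 ≤ C)
    (h : HasMaj b (BlockNorm.ofBlocks (toB6 g R₀ H₀) blk) T (fun a a' => C * Real.exp (-(r * g.dist a a')))) :
    HasMaj (weightNorm b (fun y => (g.len y)⁻¹) (fun y => inv_nonneg.mpr (hG.lenle y))) (cNorm R₀ H₀ blk hG.lenle 1) T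
      (fun a a' => C * g.L * Real.exp (-((r - α * δ) * g.dist a a'))) := by
  intro y' μ hμ y
  change g.Site at y'
  change g.Site at y
  have hb := h y' μ hμ y
  show wt g 1 y * (BlockNorm.ofBlocks (toB6 g R₀ H₀) blk).loc y (T μ) ≤ _
  rw [weightNorm_loc, wt, pow_one]
  set N := (BlockNorm.ofBlocks (toB6 g R₀ H₀) blk).loc y (T μ) with hN
  set N' := b.loc y' μ with hN'
  have hN'0 : 0 ≤ N' := b.loc_nonneg y' μ
  have hly : 0 < g.len y := hG.lenpos y
  have hly' : 0 < g.len y' := hG.lenpos y'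
  -- the transfer at γ = 1: (Lʲη)⁻¹·e^{−αδd} ≦ L·(L^{j′}η)⁻¹
  have hst : (g.len y)⁻¹ * Real.exp (-(α * δ * g.dist y y')) ≤ g.L * (g.len y')⁻¹ := by
    have h1 : Real.exp (-(α * δ * g.dist y y')) * g.len y' ≤ g.L * g.len y := by
      have := scaleTransfer_len_rpow hF 1 (by norm_num) y y'
      simpa only [abs_one, Real.rpow_one] using this
    rw [inv_mul_le_iff₀ hly, ← mul_assoc, le_mul_inv_iff₀ hly']
    calc Real.exp (-(α * δ * g.dist y y')) * g.len y' ≤ g.L * g.len y := h1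
      _ = g.len y * g.L := mul_comm _ _
  have hsplit : Real.exp (-(r * g.dist y y')) = Real.exp (-((r - α * δ) * g.dist y y')) * Real.exp (-(α * δ * g.dist y y')) := by
    rw [← Real.exp_add]; congr 1; ring
  have hE : 0 ≤ C * Real.exp (-((r - α * δ) * g.dist y y')) := mul_nonneg hC (Real.exp_nonneg _)
  calc (g.len y)⁻¹ * N ≤ (g.len y)⁻¹ * (C * Real.exp (-(r * g.dist y y')) * N') := mul_le_mul_of_nonneg_left hb (inv_nonneg.mpr hly.le)
    _ = C * Real.exp (-((r - α * δ) * g.dist y y')) * ((g.len y)⁻¹ * Real.exp (-(α * δ * g.dist y y'))) * N' := by rw [hsplit]; ring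
    _ ≤ C * Real.exp (-((r - α * δ) * g.dist y y')) * (g.L * (g.len y')⁻¹) * N' :=
        mul_le_mul_of_nonneg_right (mul_le_mul_of_nonneg_left hst hE) hN'0
    _ = C * g.L * Real.exp (-((r - α * δ) * g.dist y y')) * ((g.len y')⁻¹ * N') := by ring

/-! ## §1 The (3.44)-type member with the gauge-mode derivative on both sides: D*G₀D_U (`Thm33G0DivR.h44DsDv`) -/

omit [Fintype X] [Fintype Y] in
/-- ★★ **D\*G₀D_U FROM ITS DIRECTIONAL TWIN AND THE HÖLDER J-LETTER (`Thm33G0DivR.h44DsDv ε` ⟸ `Thm33G0DivR.h44Ds μ ε`)**: if every D\*G₀∇\*_{U,μ} maps the bond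
input Hölder class `bHX` into the scalar sup class 𝔠_W⁽⁰⁾ with `B_iD·e^{−δ₀d}`, and every `J_μ` maps the scalar input class `bHW` into `bHX` with `C_J·e^{−δ_J d}`
(cutting cost `κ_X` of `bHX`), then `D\*G₀D_U = Σ_μ (D\*G₀∇\*_{U,μ})∘J_μ` maps `bHW` into 𝔠_W⁽⁰⁾ with any `B_dD ≥ |P|·κ_X·B_iD·C_J·c`, rate `0 ≤ δ₃ ≤ δ₀`,
`δ₃ + σ ≤ δ_J`. [cite: Balaban1985BackgroundPropagators, (3.44) p.398 + (3.3) p.390 + p.398 (remarks after (3.47)); Balaban1984PropagatorsII, (2.26) p.228 + (2.52)–(2.56) pp.232–233 + Lemma 2.1 (2.61) p.234] -/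
theorem h44DsDv_of_h44Ds (hG : GeoOK g) {σ c : ℝ} (hrow : RowSum (toB6 g R₀ H₀) σ c)
    {bHW : BlockNorm (toB6 g R₀ H₀) (W → ℝ)} {bHX : BlockNorm (toB6 g R₀ H₀) (X → ℝ)} {blkW : W → g.Site}
    {G0 : Module.End ℝ (X → ℝ)} {Dds : P → Module.End ℝ (X → ℝ)} {Ds : (X → ℝ) →ₗ[ℝ] (W → ℝ)}
    {J : P → (W → ℝ) →ₗ[ℝ] (X → ℝ)} {Dv : (W → ℝ) →ₗ[ℝ] (X → ℝ)} {BiD δ₀ CJ δJ BdD δ₃ : ℝ}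
    (hBiD : 0 ≤ BiD) (hCJ : 0 ≤ CJ) (hδ₃ : 0 ≤ δ₃) (hδ₃0 : δ₃ ≤ δ₀) (hδ₃J : δ₃ + σ ≤ δJ)
    (hBdD : (Fintype.card P : ℝ) * (bHX.κ * BiD * CJ * c) ≤ BdD)
    (hDv : Dv = ∑ μ, Dds μ ∘ₗ J μ)
    (h44Ds : ∀ μ, HasMaj bHX (cNormR R₀ H₀ blkW hG.lenle 0) (Ds ∘ₗ (G0 ∘ₗ Dds μ)) (fun a b => BiD * Real.exp (-(δ₀ * g.dist a b))))
    (hJ : ∀ μ, HasMaj bHW bHX (J μ) (fun a b => CJ * Real.exp (-(δJ * g.dist a b)))) :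
    HasMaj bHW (cNormR R₀ H₀ blkW hG.lenle 0) (Ds ∘ₗ (G0 ∘ₗ Dv)) (fun a b => BdD * Real.exp (-(δ₃ * g.dist a b))) := by
  have htri : Triangle254 (toB6 g R₀ H₀) := fun a b c => hG.tri a b c
  have hsym : DistSymm (toB6 g R₀ H₀) := fun a b => hG.symm a b
  have h2 : ∀ μ ∈ (Finset.univ : Finset P), HasMaj bHW (cNormR R₀ H₀ blkW hG.lenle 0) ((Ds ∘ₗ (G0 ∘ₗ Dds μ)) ∘ₗ J μ)
      (fun a b => bHX.κ * BiD * CJ * c * Real.exp (-(δ₃ * g.dist a b))) := fun μ _ =>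
    hasMaj_comp_exp_mirror hsym htri hG.dnn hrow hBiD hCJ hδ₃ hδ₃0 hδ₃J (h44Ds μ) (hJ μ)
  rw [comp_comp_dv_eq_fsum hDv G0 Ds]
  refine (B9Thm313WholeDvFromDds.hasMaj_fsum_const _ _ _ h2).mono fun a b => ?_
  rw [Finset.card_univ]
  calc (Fintype.card P : ℝ) * (bHX.κ * BiD * CJ * c * Real.exp (-(δ₃ * g.dist a b)))
      = (Fintype.card P : ℝ) * (bHX.κ * BiD * CJ * c) * Real.exp (-(δ₃ * g.dist a b)) := by ring
    _ ≤ BdD * Real.exp (-(δ₃ * g.dist a b)) := mul_le_mul_of_nonneg_right hBdD (Real.exp_nonneg _)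

/-! ## §2 The (3.44)-type members with a left derivative: ∇_{U,ν}G₀D_U (`Letters313DMZ.dgDHd`) and ∇_UG₀D_U (`Letters313DZ.dgDH`), from the
length-weighted scalar input class -/

omit [Fintype Y] [Fintype W] in
/-- ★★ **∇_{U,ν}G₀D_U : bH → 𝔠⁽¹⁾ (`Letters313DMZ.dgDHd ν`) FROM (3.44) FOR G₀ AT THE DIRECTION LETTERS (`Thm33G0Dir.h44m (ν,μ) ε`) AND THE WITH-LENGTH J-LETTER**:
each ∇_{U,ν}G₀∇\*_{U,μ} : `bHX` → sharp blocks (`B_i·e^{−δ₀d}`) is, from `bHX` rescaled by `(L^{j′}η)⁻¹`, a letter into 𝔠⁽¹⁾ (`B_i·L·e^{−(δ₀−αδ)d}`, one transfer);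
each `J_μ : bH → bHX` with ONE LENGTH (`C_J·(Lʲη)·e^{−δ_J d}`, the shape n06-w6's `pXdDH_of_h45m` reads and `B9GradViaDivLettersAtPinsHolder.hasMaj_JcoKH_holder_len`
supplies) is a no-length letter into the rescaled class; one composition per μ ([4] (2.54) + (2.61), margin on `J_μ`), one sum: ∇_{U,ν}G₀D_U : `bH` → 𝔠⁽¹⁾ with any
`B₃ ≥ |P|·κ₀·B_i·L₀·C_J·c` (`κ_X ≤ κ₀`, `L ≤ L₀`), rate `0 ≤ δ₃ ≤ δ₀ − αδ`, `δ₃ + σ ≤ δ_J` — the source `bH` FREE, as in `Letters313DMZ`.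
[cite: Balaban1985BackgroundPropagators, Thm 3.3 (3.44) p.398 + (3.152)–(3.153) p.426 + (3.3) p.390 + p.398 (remarks after (3.47)); Balaban1984PropagatorsII, (2.26) p.228 + (2.52)–(2.56) pp.232–233 + Lemma 2.1 (2.60)–(2.61) p.234] -/
theorem dgDHd_of_h44m (hG : GeoOK g) {σ c : ℝ} (hrow : RowSum (toB6 g R₀ H₀) σ c) {dF : ℕ} {δ α L₀ : ℝ} (hF : Facts347 g R₀ H₀ dF δ α L₀)
    {bH : BlockNorm (toB6 g R₀ H₀) (W → ℝ)} {bHX : BlockNorm (toB6 g R₀ H₀) (X → ℝ)} {blk : X → g.Site}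
    {G0 : Module.End ℝ (X → ℝ)} {Dds : P → Module.End ℝ (X → ℝ)} {Ddν : Module.End ℝ (X → ℝ)}
    {J : P → (W → ℝ) →ₗ[ℝ] (X → ℝ)} {Dv : (W → ℝ) →ₗ[ℝ] (X → ℝ)} {Bi δ₀ CJ δJ κ₀ B₃ δ₃ : ℝ}
    (hBi : 0 ≤ Bi) (hCJ : 0 ≤ CJ) (hc : 0 ≤ c) (hκ : bHX.κ ≤ κ₀) (hδ₃ : 0 ≤ δ₃) (hδ₃0 : δ₃ ≤ δ₀ - α * δ) (hδ₃J : δ₃ + σ ≤ δJ)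
    (hB₃ : (Fintype.card P : ℝ) * (κ₀ * (Bi * L₀) * CJ * c) ≤ B₃)
    (hDv : Dv = ∑ μ, Dds μ ∘ₗ J μ)
    (h44m : ∀ μ, HasMaj bHX (BlockNorm.ofBlocks (toB6 g R₀ H₀) blk) (Ddν ∘ₗ (G0 ∘ₗ Dds μ)) (fun a b => Bi * Real.exp (-(δ₀ * g.dist a b))))
    (hJ : ∀ μ, HasMaj bH bHX (J μ) (fun a b => CJ * g.len a * Real.exp (-(δJ * g.dist a b)))) :
    HasMaj bH (cNorm R₀ H₀ blk hG.lenle 1) (Ddν ∘ₗ G0 ∘ₗ Dv) (fun a b => B₃ * Real.exp (-(δ₃ * g.dist a b))) := by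
  have htri : Triangle254 (toB6 g R₀ H₀) := fun a b c => hG.tri a b c
  have hsym : DistSymm (toB6 g R₀ H₀) := fun a b => hG.symm a b
  have hL0 : 0 ≤ g.L := le_trans zero_le_one hF.one_le_L
  have hL₀ : g.L ≤ L₀ := hF.L_le
  -- the bond input class rescaled by (L^{j′}η)⁻¹: the middle space
  set bM : BlockNorm (toB6 g R₀ H₀) (X → ℝ) := weightNorm bHX (fun y => (g.len y)⁻¹) (fun y => inv_nonneg.mpr (hG.lenle y)) with hbM
  have h1 : ∀ μ, HasMaj bM (cNorm R₀ H₀ blk hG.lenle 1) (Ddν ∘ₗ (G0 ∘ₗ Dds μ))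
      (fun a b => Bi * g.L * Real.exp (-((δ₀ - α * δ) * g.dist a b))) := fun μ =>
    hasMaj_cNorm_one_of_ofBlocks_lenInv hG hF hBi (h44m μ)
  have h2 : ∀ μ, HasMaj bH bM (J μ) (fun a b => CJ * Real.exp (-(δJ * g.dist a b))) := fun μ =>
    B9Thm33G0DirXHolderFromDds.hasMaj_lenInv_of_len hG (hJ μ)
  have h3 : ∀ μ ∈ (Finset.univ : Finset P), HasMaj bH (cNorm R₀ H₀ blk hG.lenle 1) ((Ddν ∘ₗ (G0 ∘ₗ Dds μ)) ∘ₗ J μ)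
      (fun a b => κ₀ * (Bi * L₀) * CJ * c * Real.exp (-(δ₃ * g.dist a b))) := by
    intro μ _
    refine (hasMaj_comp_exp_mirror hsym htri hG.dnn hrow (mul_nonneg hBi hL0) hCJ hδ₃ hδ₃0 hδ₃J (h1 μ) (h2 μ)).mono fun a b => ?_
    have hκM : bM.κ = bHX.κ := rfl
    rw [hκM, toB6_dist]
    have hk1 : bHX.κ * (Bi * g.L) * CJ * c ≤ κ₀ * (Bi * L₀) * CJ * c :=
      mul_le_mul_of_nonneg_right (mul_le_mul_of_nonneg_right
        (mul_le_mul hκ (mul_le_mul_of_nonneg_left hL₀ hBi) (mul_nonneg hBi hL0) (le_trans bHX.κ_nonneg hκ)) hCJ) hc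
    exact mul_le_mul_of_nonneg_right hk1 (Real.exp_nonneg _)
  rw [comp_comp_dv_eq_fsum hDv G0 Ddν]
  refine (B9Thm313WholeDvFromDds.hasMaj_fsum_const _ _ _ h3).mono fun a b => ?_
  rw [Finset.card_univ]
  calc (Fintype.card P : ℝ) * (κ₀ * (Bi * L₀) * CJ * c * Real.exp (-(δ₃ * g.dist a b)))
      = (Fintype.card P : ℝ) * (κ₀ * (Bi * L₀) * CJ * c) * Real.exp (-(δ₃ * g.dist a b)) := by ring
    _ ≤ B₃ * Real.exp (-(δ₃ * g.dist a b)) := mul_le_mul_of_nonneg_right hB₃ (Real.exp_nonneg _)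

omit [Fintype W] in
/-- ★ **∇_UG₀D_U : bH → 𝔠_Y⁽¹⁾ (`Letters313DZ.dgDH`)** with the slice-diagonal ∇_U of the letters written as `Σ_ν Π_ν∘∇_{U,ν}` (`hD`; `Π_ν : 𝔠⁽¹⁾ → 𝔠_Y⁽¹⁾` with
`C_Π·e^{−δ_Π d}`, `hPr`): `∇_UG₀D_U = Σ_ν Π_ν∘(∇_{U,ν}G₀D_U)`, so `dgDHd_of_h44m` per ν and one more row sum give any `B₃′ ≥ |P|·C_Π·B₃·c` at a rate
`0 ≤ δ₃′ ≤ δ₃`, `δ₃′ + σ ≤ δ_Π`. [cite: Balaban1985BackgroundPropagators, Thm 3.3 (3.44) p.398 + (3.42) p.397 («∇_UG(U)», all directions) + (3.152)–(3.153) p.426; Balaban1984PropagatorsII, (2.52)–(2.56) pp.232–233 + Lemma 2.1 (2.60)–(2.61) p.234] -/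
theorem dgDH_of_h44m (hG : GeoOK g) {σ c : ℝ} (hrow : RowSum (toB6 g R₀ H₀) σ c) {dF : ℕ} {δ α L₀ : ℝ} (hF : Facts347 g R₀ H₀ dF δ α L₀)
    {bH : BlockNorm (toB6 g R₀ H₀) (W → ℝ)} {bHX : BlockNorm (toB6 g R₀ H₀) (X → ℝ)} {blk : X → g.Site} {blkY : Y → g.Site}
    {G0 : Module.End ℝ (X → ℝ)} {Dd Dds : P → Module.End ℝ (X → ℝ)} {Pr : P → (X → ℝ) →ₗ[ℝ] (Y → ℝ)} {D : (X → ℝ) →ₗ[ℝ] (Y → ℝ)}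
    {J : P → (W → ℝ) →ₗ[ℝ] (X → ℝ)} {Dv : (W → ℝ) →ₗ[ℝ] (X → ℝ)} {Bi δ₀ CJ δJ κ₀ Cpr δpr B₃ δ₃ B₃' δ₃' : ℝ}
    (hBi : 0 ≤ Bi) (hCJ : 0 ≤ CJ) (hCpr : 0 ≤ Cpr) (hc : 0 ≤ c) (hκ : bHX.κ ≤ κ₀) (hδ₃ : 0 ≤ δ₃) (hδ₃0 : δ₃ ≤ δ₀ - α * δ) (hδ₃J : δ₃ + σ ≤ δJ)
    (hB₃ : (Fintype.card P : ℝ) * (κ₀ * (Bi * L₀) * CJ * c) ≤ B₃) (hδ₃' : 0 ≤ δ₃') (hδ₃'₃ : δ₃' ≤ δ₃) (hδ₃'pr : δ₃' + σ ≤ δpr)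
    (hB₃' : (Fintype.card P : ℝ) * (Cpr * B₃ * c) ≤ B₃')
    (hDv : Dv = ∑ μ, Dds μ ∘ₗ J μ) (hD : D = ∑ ν, Pr ν ∘ₗ Dd ν)
    (h44m : ∀ ν μ, HasMaj bHX (BlockNorm.ofBlocks (toB6 g R₀ H₀) blk) (Dd ν ∘ₗ (G0 ∘ₗ Dds μ)) (fun a b => Bi * Real.exp (-(δ₀ * g.dist a b))))
    (hJ : ∀ μ, HasMaj bH bHX (J μ) (fun a b => CJ * g.len a * Real.exp (-(δJ * g.dist a b))))
    (hPr : ∀ ν, HasMaj (cNorm R₀ H₀ blk hG.lenle 1) (cNorm R₀ H₀ blkY hG.lenle 1) (Pr ν) (fun a b => Cpr * Real.exp (-(δpr * g.dist a b)))) :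
    HasMaj bH (cNorm R₀ H₀ blkY hG.lenle 1) (D ∘ₗ G0 ∘ₗ Dv) (fun a b => B₃' * Real.exp (-(δ₃' * g.dist a b))) := by
  have htri : Triangle254 (toB6 g R₀ H₀) := fun a b c => hG.tri a b c
  have hB₃0 : 0 ≤ B₃ := le_trans (mul_nonneg (Nat.cast_nonneg _) (mul_nonneg (mul_nonneg (mul_nonneg (le_trans bHX.κ_nonneg hκ)
    (mul_nonneg hBi (le_trans (le_trans zero_le_one hF.one_le_L) hF.L_le))) hCJ) hc)) hB₃
  have heq : D ∘ₗ G0 ∘ₗ Dv = ∑ ν, Pr ν ∘ₗ (Dd ν ∘ₗ G0 ∘ₗ Dv) := by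
    rw [hD, fsum_comp]
    rfl
  have hin : ∀ ν, HasMaj bH (cNorm R₀ H₀ blk hG.lenle 1) (Dd ν ∘ₗ G0 ∘ₗ Dv) (fun a b => B₃ * Real.exp (-(δ₃ * g.dist a b))) := fun ν =>
    dgDHd_of_h44m hG hrow hF hBi hCJ hc hκ hδ₃ hδ₃0 hδ₃J hB₃ hDv (h44m ν) hJ
  have h2 : ∀ ν ∈ (Finset.univ : Finset P), HasMaj bH (cNorm R₀ H₀ blkY hG.lenle 1) (Pr ν ∘ₗ (Dd ν ∘ₗ G0 ∘ₗ Dv))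
      (fun a b => Cpr * B₃ * c * Real.exp (-(δ₃' * g.dist a b))) := by
    intro ν _
    refine (hasMaj_comp_exp htri hG.dnn hrow hCpr hB₃0 hδ₃' hδ₃'₃ hδ₃'pr (hPr ν) (hin ν)).mono fun a b => le_of_eq ?_
    simp only [cNorm_κ, toB6_dist]
    ring
  rw [heq]
  refine (B9Thm313WholeDvFromDds.hasMaj_fsum_const _ _ _ h2).mono fun a b => ?_
  rw [Finset.card_univ]
  calc (Fintype.card P : ℝ) * (Cpr * B₃ * c * Real.exp (-(δ₃' * g.dist a b)))
      = (Fintype.card P : ℝ) * (Cpr * B₃ * c) * Real.exp (-(δ₃' * g.dist a b)) := by ring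
    _ ≤ B₃' * Real.exp (-(δ₃' * g.dist a b)) := mul_le_mul_of_nonneg_right hB₃' (Real.exp_nonneg _)

/-! ## §3 The (3.45)-type probe member with the bundled ∇_U and the Y-probes: Φ^Y_β∘∇_U∘G₀∘D_U (`Letters313HZ.pYDH`) -/

omit [Fintype X] [Fintype Y] [Fintype W] in
/-- ★★ **Φ^Y_β∘∇_U∘G₀∘D_U : bW → 𝔠_{P_Y}^{(β−1)} (`Letters313HZ.pYDH β`) FROM A DIRECTIONAL Φ^Y-(3.45) MEMBER AND THE WITH-LENGTH J-LETTER** — the Y-probe, bundled-∇_U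
twin of n06-w6's `pXdDH_of_h45m` (same composition: `hasMaj_cNormR_of_ofBlocks_rpow_lenInv` moves (3.45)'s output power and the source weight, `hasMaj_lenInv_of_len`
the J-letter's length, [4] (2.54) + (2.61) per μ, one sum): if every `Φ^Y_β∘∇_U∘G₀∘∇\*_{U,μ}` maps `bHX` into the sharp Y-probe blocks with `B_i·(Lʲη)^{−β}·e^{−δ₀d}`
(`h45Y` — the Y-probe relabelling `Φ^Y∘∇_U = Σ_ν Φ^Y∘Π_ν∘∇_{U,ν}` of `Thm33G0Dir.h45m`, a HYPOTHESIS here) and every `J_μ : bW → bHX` has `C_J·(Lʲη)·e^{−δ_J d}`, then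
`BhD ≥ |P|·κ₀·B_i·L₀·C_J·c`, `0 ≤ δ₃ ≤ δ₀ − αδ`, `δ₃ + σ ≤ δ_J` serve. [cite: Balaban1985BackgroundPropagators, Thm 3.13 p.426 + (3.45) p.398 + (3.152)–(3.153) p.426 + (3.3) p.390 + p.398 (remarks after (3.47)); Balaban1984PropagatorsII, (2.26) p.228 + (2.52)–(2.56) pp.232–233 + Lemma 2.1 (2.60)–(2.61) p.234] -/
theorem pYDH_of_h45Y (hG : GeoOK g) {σ c : ℝ} (hrow : RowSum (toB6 g R₀ H₀) σ c) {dF : ℕ} {δ α L₀ : ℝ} (hF : Facts347 g R₀ H₀ dF δ α L₀)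
    {PY : Type} [Fintype PY] {bW : BlockNorm (toB6 g R₀ H₀) (W → ℝ)} {bHX : BlockNorm (toB6 g R₀ H₀) (X → ℝ)} {blkPY : PY → g.Site}
    {G0 : Module.End ℝ (X → ℝ)} {Dds : P → Module.End ℝ (X → ℝ)} {D : (X → ℝ) →ₗ[ℝ] (Y → ℝ)} {ΦY : (Y → ℝ) →ₗ[ℝ] (PY → ℝ)}
    {J : P → (W → ℝ) →ₗ[ℝ] (X → ℝ)} {Dv : (W → ℝ) →ₗ[ℝ] (X → ℝ)} {β Bi δ₀ CJ δJ κ₀ BhD δ₃ : ℝ}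
    (hBi : 0 ≤ Bi) (hCJ : 0 ≤ CJ) (hc : 0 ≤ c) (hκ : bHX.κ ≤ κ₀) (hδ₃ : 0 ≤ δ₃) (hδ₃0 : δ₃ ≤ δ₀ - α * δ) (hδ₃J : δ₃ + σ ≤ δJ)
    (hBhD : (Fintype.card P : ℝ) * (κ₀ * (Bi * L₀) * CJ * c) ≤ BhD)
    (hDv : Dv = ∑ μ, Dds μ ∘ₗ J μ)
    (h45Y : ∀ μ, HasMaj bHX (BlockNorm.ofBlocks (toB6 g R₀ H₀) blkPY) (ΦY ∘ₗ (D ∘ₗ (G0 ∘ₗ Dds μ)))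
      (fun a b => Bi * g.len a ^ (-β) * Real.exp (-(δ₀ * g.dist a b))))
    (hJ : ∀ μ, HasMaj bW bHX (J μ) (fun a b => CJ * g.len a * Real.exp (-(δJ * g.dist a b)))) :
    HasMaj bW (cNormR R₀ H₀ blkPY hG.lenle (β - 1)) ((ΦY ∘ₗ D ∘ₗ G0) ∘ₗ Dv) (fun a b => BhD * Real.exp (-(δ₃ * g.dist a b))) := by
  have htri : Triangle254 (toB6 g R₀ H₀) := fun a b c => hG.tri a b c
  have hsym : DistSymm (toB6 g R₀ H₀) := fun a b => hG.symm a b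
  have hL0 : 0 ≤ g.L := le_trans zero_le_one hF.one_le_L
  have hL₀ : g.L ≤ L₀ := hF.L_le
  set bM : BlockNorm (toB6 g R₀ H₀) (X → ℝ) := weightNorm bHX (fun y => (g.len y)⁻¹) (fun y => inv_nonneg.mpr (hG.lenle y)) with hbM
  have h1 : ∀ μ, HasMaj bM (cNormR R₀ H₀ blkPY hG.lenle (β - 1)) (ΦY ∘ₗ (D ∘ₗ (G0 ∘ₗ Dds μ)))
      (fun a b => Bi * g.L * Real.exp (-((δ₀ - α * δ) * g.dist a b))) := fun μ =>
    B9Thm33G0DirXHolderFromDds.hasMaj_cNormR_of_ofBlocks_rpow_lenInv hG hF hBi (h45Y μ)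
  have h2 : ∀ μ, HasMaj bW bM (J μ) (fun a b => CJ * Real.exp (-(δJ * g.dist a b))) := fun μ =>
    B9Thm33G0DirXHolderFromDds.hasMaj_lenInv_of_len hG (hJ μ)
  have h3 : ∀ μ ∈ (Finset.univ : Finset P), HasMaj bW (cNormR R₀ H₀ blkPY hG.lenle (β - 1)) ((ΦY ∘ₗ (D ∘ₗ (G0 ∘ₗ Dds μ))) ∘ₗ J μ)
      (fun a b => κ₀ * (Bi * L₀) * CJ * c * Real.exp (-(δ₃ * g.dist a b))) := by
    intro μ _
    refine (hasMaj_comp_exp_mirror hsym htri hG.dnn hrow (mul_nonneg hBi hL0) hCJ hδ₃ hδ₃0 hδ₃J (h1 μ) (h2 μ)).mono fun a b => ?_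
    have hκM : bM.κ = bHX.κ := rfl
    rw [hκM, toB6_dist]
    have hk1 : bHX.κ * (Bi * g.L) * CJ * c ≤ κ₀ * (Bi * L₀) * CJ * c :=
      mul_le_mul_of_nonneg_right (mul_le_mul_of_nonneg_right
        (mul_le_mul hκ (mul_le_mul_of_nonneg_left hL₀ hBi) (mul_nonneg hBi hL0) (le_trans bHX.κ_nonneg hκ)) hCJ) hc
    exact mul_le_mul_of_nonneg_right hk1 (Real.exp_nonneg _)
  have heq : (ΦY ∘ₗ D ∘ₗ G0) ∘ₗ Dv = ∑ μ, (ΦY ∘ₗ (D ∘ₗ (G0 ∘ₗ Dds μ))) ∘ₗ J μ := by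
    rw [B9Thm313WholeDvFromDds.comp_dv_eq_fsum hDv (ΦY ∘ₗ D ∘ₗ G0)]
    rfl
  rw [heq]
  refine (B9Thm313WholeDvFromDds.hasMaj_fsum_const _ _ _ h3).mono fun a b => ?_
  rw [Finset.card_univ]
  calc (Fintype.card P : ℝ) * (κ₀ * (Bi * L₀) * CJ * c * Real.exp (-(δ₃ * g.dist a b)))
      = (Fintype.card P : ℝ) * (κ₀ * (Bi * L₀) * CJ * c) * Real.exp (-(δ₃ * g.dist a b)) := by ring
    _ ≤ BhD * Real.exp (-(δ₃ * g.dist a b)) := mul_le_mul_of_nonneg_right hBhD (Real.exp_nonneg _)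

end

end Literature.MathematicalPhysics.QuantumFieldTheory.Balaban1983to89.B9Thm313WholeDvHolderFromDds
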